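import Summits.NavierStokesRegularity.NavierStokesRegularity.Theses.ContinuousAlignment
import Literature.Analysis.FluidPDE.SelfSimilar

/-!
# Birth skeleton — crux `ContinuousAlignmentCriterion` (W2, the rate-free Constantin–Fefferman criterion)

Route `route-NavierStokesRegularity-ContinuousAlignment`, crux item `stmt-NavierStokesRegularity-18584`
(rev-1 restatement of retired `stmt-NavierStokesRegularity-18334`: the direction `ξ = ω/|ω|` is written inline as
`‖ω x‖⁻¹ • ω x`, so neither the route nor this workfile imports `Literature.Analysis.FluidPDE.Vorticity`).
Workfile `Cruxes/ContinuousAlignmentCriterion/Lines/birth.lean` — never imported by the tree; `sorry` only in stubs.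

LINE (by cases on the VORTICITY-DOMINATED regime
`VD : ∃ C, ∀ t ∈ [0,T), ∀ x, ∃ y, ‖u t x‖² ≤ C (1 + ‖ω t y‖)`, i.e. `‖u(t)‖²_∞ ≲ 1 + ‖ω(t)‖_∞` uniformly in `t < T`):
* `stub_alignedZoom` — in the VD regime a solution that does NOT extend smoothly past `T` is zoomed (KNSS 2009 §6
  rescaling `v_k(y,s) = λ_k⁻¹ u(y_k + y/λ_k, t_k + s/λ_k²)` with `λ_k = sup_{t ≤ t_k} ‖u(t)‖_∞ → ∞`, CENTRED AT
  VORTICITY NEAR-RECORDS `(t_k, y_k)`; KNSS §4 `C¹_loc` compactness of bounded mild solutions) to a smooth bounded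
  ancient mild solution `v` (ν = 1) with bounded gradient whose vorticity is everywhere parallel to ONE unit vector
  `e` and which is not spatially constant: VD gives `|curl v_k(0,0)| = |ω(t_k,y_k)|/λ_k² ≳ 1/C`, so the limit
  vorticity does not vanish (the role the Type I rate plays in Giga–Miura 2011 / Giga–Hsu–Maekawa 2014 Thm 1.2);
  the fixed-scale modulus on `{|ω| > d}` becomes exact constancy of direction on `{curl v(t,·) ≠ 0}` (threshold
  `d/λ_k² → 0`, modulus `δ λ_k → ∞`); slice-wise constancy `e(t)` upgrades to one `e`: on `{curl v(t,·) ≠ 0} = U × ℝe`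
  the vorticity equation gives `(∂_e v)_⊥ = ė(t)`, and boundedness of `v` along `e`-lines forces `ė = 0`
  (plus `L^∞`-mild forward uniqueness / backward uniqueness across a vorticity-free slice).
  REGISTRAR DELTA (2026-08-17, vs. the skeleton registered on retired stmt-18334): the conclusion no longer asks for the
  packaged `IsKNSSBlowupLimit v` (whose normalisation `sup |v| = 1` belongs to the VELOCITY-centred zoom, which can lose
  the vorticity to spatial infinity because VD's witness `y` is not localised near the velocity record); it asks exactly
  for the two projections the Liouville stub consumes (`IsBoundedAncientMildSolution 1 v`, smoothness on `(-∞,0) × ℝ³`).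
  This weakens the stub's conclusion (strictly more provable) and leaves the composition unchanged.
* `stub_unidirectionalLiouville` — a smooth bounded ancient mild solution with bounded gradient and unidirectional
  vorticity is spatially constant (`∂_e v` is a bounded harmonic field ⇒ 0; `v_e` constant by the mild pressure law;
  planar descent to the PROVED in-tree KNSS 2D Liouville theorem `KNSS2009_liouville_planar_holds`). VERBATIM the
  shared open item `stmt-NavierStokesRegularity-1923` of route DirectionDissipationQuantum (grounded provable-now (M)).
* `stub_velocityDominated` — the complementary velocity-dominated regime `¬VD` (Burgers-vortex-like strained 2D
  profiles, Majda–Bertozzi 2002 (2.72)): the OPEN HALF of the criterion, named as such in the route header.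
`ContinuousAlignmentCriterion_of : ContinuousAlignmentCriterion` is the skeleton theorem (A12 shape): it concludes the
route crux BY NAME and invokes the three stubs by name; kernel-checked with `sorry` occurring only inside the three
`stub_*` declarations; it becomes the crux proof when the last stub is discharged (`ledger propose … --supports
stmt-NavierStokesRegularity-18584` must prove a registered stub by name + signature).
-/

namespace Summit.NavierStokesRegularity.NavierStokesRegularity.Cruxes.ContinuousAlignmentCriterion.Birth

open Summit.NavierStokesRegularity.NavierStokesRegularity.Theses.ContinuousAlignment


/-- STUB 1 — ALIGNED ZOOM in the vorticity-dominated regime (KNSS2009 §6 rescaling centred at vorticity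
near-records + §4 `C¹_loc` compactness; GigaMiura2011 / GigaHsuMaekawa2014 Thm 1.2 without the Type I rate, VD replacing
it to keep the limit vorticity non-zero; the fixed-scale direction modulus becomes exact alignment in the limit; one `e`
for all `t < 0` by the `(∂_e v)_⊥ = ė` argument). Conclusion = exactly the hypotheses of `stub_unidirectionalLiouville`
plus `¬ spatially constant`. Size L. -/
theorem stub_alignedZoom : ∀ (ν T : ℝ), 0 < ν → 0 < T → ∀ (u : ℝ → EuclideanSpace ℝ (Fin 3) → EuclideanSpace ℝ (Fin 3)) (p : ℝ → EuclideanSpace ℝ (Fin 3) → ℝ), Literature.Analysis.FluidPDE.IsClassicalNSSolutionOn (Set.Ico 0 T) ν 0 u p → Literature.Analysis.FluidPDE.IsLerayHopfOn T ν 0 (u 0) u → Literature.Analysis.FluidPDE.HasRapidSpatialDecay (u 0) → ∀ d : ℝ, 0 < d → (∀ ε : ℝ, 0 < ε → ∃ δ : ℝ, 0 < δ ∧ ∀ t ∈ Set.Ico 0 T, ∀ x y : EuclideanSpace ℝ (Fin 3), d < ‖Literature.Analysis.FluidPDE.curl (u t) x‖ → d < ‖Literature.Analysis.FluidPDE.curl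 (u t) y‖ → ‖x - y‖ < δ → Real.sqrt (1 - (inner ℝ (‖Literature.Analysis.FluidPDE.curl (u t) x‖⁻¹ • Literature.Analysis.FluidPDE.curl (u t) x) (‖Literature.Analysis.FluidPDE.curl (u t) y‖⁻¹ • Literature.Analysis.FluidPDE.curl (u t) y)) ^ 2) ≤ ε) → (∃ C : ℝ, ∀ t ∈ Set.Ico 0 T, ∀ x : EuclideanSpace ℝ (Fin 3), ∃ y : EuclideanSpace ℝ (Fin 3), ‖u t x‖ ^ 2 ≤ C * (1 + ‖Literature.Analysis.FluidPDE.curl (u t) y‖)) → ¬ Literature.Analysis.FluidPDE.HasSmoothExtensionPast ν 0 u T → ∃ (v : ℝ → EuclideanSpace ℝ (Fin 3) → EuclideanSpace ℝ (Fin 3)) (e : EuclideanSpace ℝ (Fin 3)), Literature.Analysis.FluidPDE.IsBoundedAncientMildSolution 1 v ∧ ContDiffOn ℝ (⊤ : ℕ∞) (Function.uncurry v) (Set.Iio 0 ×ˢ Set.univ) ∧ ‖e‖ = 1 ∧ (∃ C : ℝ, ∀ t < 0, ∀ x, ‖fderiv ℝ (v t) x‖ ≤ C) ∧ (∀ t <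 0, ∀ x, ∃ c : ℝ, Literature.Analysis.FluidPDE.curl (v t) x = c • e) ∧ ¬ (∀ t < 0, ∀ x y : EuclideanSpace ℝ (Fin 3), v t x = v t y) := by
  sorry

/-- STUB 2 — UNIDIRECTIONAL ANCIENT LIOUVILLE (verbatim the shared open item stmt-NavierStokesRegularity-1923 of route
DirectionDissipationQuantum: `∂_e v` bounded harmonic ⇒ 0, planar descent, the PROVED in-tree KNSS 2D Liouville theorem
`KNSS2009_liouville_planar_holds`). Size M. -/
theorem stub_unidirectionalLiouville : ∀ (v : ℝ → EuclideanSpace ℝ (Fin 3) → EuclideanSpace ℝ (Fin 3)) (e : EuclideanSpace ℝ (Fin 3)), ‖e‖ = 1 → Literature.Analysis.FluidPDE.IsBoundedAncientMildSolution 1 v → ContDiffOn ℝ (⊤ : ℕ∞) (Function.uncurry v) (Set.Iio 0 ×ˢ Set.univ) → (∃ C : ℝ, ∀ t < 0, ∀ x, ‖fderiv ℝ (v t) x‖ ≤ C) → (∀ t < 0, ∀ x, ∃ c : ℝ, Literature.Analysis.FluidPDE.curl (v t) x = c • e) → ∀ t < 0, ∀ x y, v t x = v t y := by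
  sorry

/-- STUB 3 — VELOCITY-DOMINATED ALIGNED REGIME (the open half: `¬VD`, Burgers-vortex-like strained 2D profiles,
MajdaBertozzi2002 (2.72)); continuous alignment on `{|ω| > d}` must still force the smooth extension past `T`.
Size XL / open. -/
theorem stub_velocityDominated : ∀ (ν T : ℝ), 0 < ν → 0 < T → ∀ (u : ℝ → EuclideanSpace ℝ (Fin 3) → EuclideanSpace ℝ (Fin 3)) (p : ℝ → EuclideanSpace ℝ (Fin 3) → ℝ), Literature.Analysis.FluidPDE.IsClassicalNSSolutionOn (Set.Ico 0 T) ν 0 u p → Literature.Analysis.FluidPDE.IsLerayHopfOn T ν 0 (u 0) u → Literature.Analysis.FluidPDE.HasRapidSpatialDecay (u 0) → ∀ d : ℝ, 0 < d → (∀ ε : ℝ, 0 < ε → ∃ δ : ℝ, 0 < δ ∧ ∀ t ∈ Set.Ico 0 T, ∀ x y : EuclideanSpace ℝ (Fin 3), d < ‖Literature.Analysis.FluidPDE.curl (u t) x‖ → d < ‖Literature.Analysis.FluidPDE.curl (u t) y‖ → ‖x - y‖ < δ → Real.sqrt (1 - (inner ℝ (‖Literature.Analysis.FluidPDE.curl (u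 t) x‖⁻¹ • Literature.Analysis.FluidPDE.curl (u t) x) (‖Literature.Analysis.FluidPDE.curl (u t) y‖⁻¹ • Literature.Analysis.FluidPDE.curl (u t) y)) ^ 2) ≤ ε) → ¬ (∃ C : ℝ, ∀ t ∈ Set.Ico 0 T, ∀ x : EuclideanSpace ℝ (Fin 3), ∃ y : EuclideanSpace ℝ (Fin 3), ‖u t x‖ ^ 2 ≤ C * (1 + ‖Literature.Analysis.FluidPDE.curl (u t) y‖)) → Literature.Analysis.FluidPDE.HasSmoothExtensionPast ν 0 u T := by
  sorry

/-- SKELETON THEOREM (kernel-checked; no `sorry` here — only inside the three stubs it invokes by name): the route crux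
BY NAME, by cases on the vorticity-dominated regime VD. In the VD regime, if the solution did not extend,
`stub_alignedZoom` would produce a non-constant unidirectional smooth bounded ancient mild solution `v`, which
`stub_unidirectionalLiouville` makes spatially constant — contradiction; in the `¬VD` regime `stub_velocityDominated`
gives the extension directly. -/
theorem ContinuousAlignmentCriterion_of : ContinuousAlignmentCriterion := by
  intro ν T hν hT u p hcl hLH hdec d hd hal
  by_cases hVD : ∃ C : ℝ, ∀ t ∈ Set.Ico 0 T, ∀ x : EuclideanSpace ℝ (Fin 3), ∃ y : EuclideanSpace ℝ (Fin 3), ‖u t x‖ ^ 2 ≤ C * (1 + ‖Literature.Analysis.FluidPDE.curl (u t) y‖)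
  · by_contra hns
    obtain ⟨v, e, hv, hsm, he, hgrad, hdir, hnc⟩ :=
      stub_alignedZoom ν T hν hT u p hcl hLH hdec d hd hal hVD hns
    exact hnc (stub_unidirectionalLiouville v e he hv hsm hgrad hdir)
  · exact stub_velocityDominated ν T hν hT u p hcl hLH hdec d hd hal hVD

end Summit.NavierStokesRegularity.NavierStokesRegularity.Cruxes.ContinuousAlignmentCriterion.Birth
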